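import Literature.AlgebraicGeometry.Motives.FaltingsECEndCoreOrdinaryProofs
import HarnessLib

/-!
# Algebra of the Tate module for the ordinary line: divisibility, Cayley–Hamilton, determinants
(route `SkinnerWilesDefectOne`, item stmt-Langlands-12922 `FiveIsogenyEllipticCurves`, helper)

Elementary `ℤ_ℓ`-module facts about `T = T_ℓ E` used to extract Serre's ordinary line
(1968, IV A.2.2) from the finite-level receptacles `E[ℓᵐ] ∩ E₁`:

* `proj_eq_zero_iff_exists_pow_smul`: `ker (T → E[ℓᵐ]) = ℓᵐ T` (iterating `TateModule.div`);
* `exists_pow_smul_of_natCast_smul_eq`: if `k • t ∈ ℓᵐ T` with `k = ℓᵉ k'`, `ℓ ∤ k'`, `e ≤ m`,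
  then `t ∈ ℓ^{m-e} T` (`T` is torsion free and `k'` is a unit of `ℤ_ℓ`);
* `comp_sub_smul_eq_zero_of_det`: for a `ℤ_ℓ`-linear endomorphism `g` of the free rank-two
  module `T` with `det g = u` and `g ⊗ ℚ_ℓ - 1` not surjective on `V = ℚ_ℓ ⊗ T`, one has
  `(g - 1) ∘ (g - u) = 0 = (g - u) ∘ (g - 1)` (Cayley–Hamilton: `tr g = 1 + u`);
* `dvd_det_sub_one_of_forall`: if `(g - 1) T ⊆ ℓ T` then `ℓ ∣ det g - 1`.

References: J.-P. Serre, *Abelian ℓ-adic representations and elliptic curves* (1968), IV A.2.2;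
J. H. Silverman, *The Arithmetic of Elliptic Curves* (2009), III.§7.
-/

noncomputable section

-- `Summit.Langlands.Langlands.…`: summit = sub-problem name (D-0017 layout), as in every Theorems file here.
set_option linter.dupNamespace false

open Literature.NumberTheory.EllipticCurves Literature.NumberTheory.EllipticCurves.TateModule
open Polynomial

namespace Summit.Langlands.Langlands.Theorems.FiveIsogenyEllipticCurves

universe u

/-! ### Divisibility in the Tate module -/

section Tate

variable {A : Type u} [AddCommGroup A] {ℓ : ℕ} [hℓ : Fact ℓ.Prime]

/-- **`ker (T_ℓ A → A[ℓᵐ]) = ℓᵐ T_ℓ A`.**  An element of the Tate module with vanishing `m`-th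
component is `ℓᵐ` times an element (iterate `TateModule.div`: if `a_m = 0` then `a₁ = 0`, write
`a = ℓ a'` with `a'_{m-1} = a_m = 0`), and conversely. [folklore] -/
theorem proj_eq_zero_iff_exists_pow_smul (m : ℕ) (x : TateModule A ℓ) :
    proj ℓ m x = 0 ↔ ∃ s : TateModule A ℓ, (ℓ : ℤ_[ℓ]) ^ m • s = x := by
  constructor
  · induction m generalizing x with
    | zero => intro _; exact ⟨x, by rw [pow_zero, one_smul]⟩
    | succ m ih =>
      intro hx
      have h1 : proj ℓ 1 x = 0 := by
        have := pow_smul_proj_self_add m 1 x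
        rw [hx, smul_zero] at this
        exact this.symm
      have hdiv : proj ℓ m (div x h1) = 0 := by rw [proj_div, hx]
      obtain ⟨s, hs⟩ := ih (div x h1) hdiv
      refine ⟨s, ?_⟩
      rw [pow_succ, mul_comm, mul_smul, hs, p_smul_div]
  · rintro ⟨s, rfl⟩
    rw [proj_pow_smul, pow_smul_proj]

/-- Multiplication by `ℓᵉ` is injective on `T_ℓ A` (torsion freeness,
`TateModule.eq_zero_of_pow_smul_eq_zero`). [folklore] -/
theorem pow_smul_injective (e : ℕ) {a b : TateModule A ℓ}
    (h : (ℓ : ℤ_[ℓ]) ^ e • a = (ℓ : ℤ_[ℓ]) ^ e • b) : a = b := by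
  rw [← sub_eq_zero] at h ⊢
  rw [← smul_sub] at h
  exact eq_zero_of_pow_smul_eq_zero h

/-- **Divisibility by bounded integers.**  If `k • t = ℓᵐ • s` in `T_ℓ A` with `k = ℓᵉ k'`,
`ℓ ∤ k'` and `e ≤ m`, then `t = ℓ^{m-e} • s'` for some `s'`: cancel `ℓᵉ` (torsion freeness) and
invert the unit `k'` of `ℤ_ℓ`. [folklore] -/
theorem exists_pow_smul_of_natCast_smul_eq {k' e m : ℕ} (hk' : ¬ ℓ ∣ k') (hem : e ≤ m)
    {t s : TateModule A ℓ} (h : ((ℓ ^ e * k' : ℕ) : ℤ_[ℓ]) • t = (ℓ : ℤ_[ℓ]) ^ m • s) :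
    ∃ s' : TateModule A ℓ, (ℓ : ℤ_[ℓ]) ^ (m - e) • s' = t := by
  have hu : IsUnit ((k' : ℤ) : ℤ_[ℓ]) := by
    rw [PadicInt.isUnit_iff]
    refine le_antisymm (PadicInt.norm_le_one _) (not_lt.mp fun hlt => hk' ?_)
    rw [PadicInt.norm_int_lt_one_iff_dvd] at hlt
    exact_mod_cast hlt
  obtain ⟨u, hu'⟩ := hu
  have hk'u : ((k' : ℕ) : ℤ_[ℓ]) = u := by rw [hu']; simp
  obtain ⟨d, rfl⟩ := exists_add_of_le hem
  have h2 : (ℓ : ℤ_[ℓ]) ^ e • ((u : ℤ_[ℓ]) • t) = (ℓ : ℤ_[ℓ]) ^ e • ((ℓ : ℤ_[ℓ]) ^ d • s) := by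
    rw [← mul_smul, ← mul_smul, ← pow_add, ← hk'u]
    exact_mod_cast h
  have h3 : (u : ℤ_[ℓ]) • t = (ℓ : ℤ_[ℓ]) ^ d • s := pow_smul_injective e h2
  refine ⟨(u⁻¹ : ℤ_[ℓ]ˣ) • s, ?_⟩
  rw [Nat.add_sub_cancel_left, Units.smul_def, smul_comm, ← h3, ← mul_smul, Units.inv_mul, one_smul]

/-- If `k • t ∈ ℓᵐ T_ℓ A` for a natural number `0 < k < ℓᵐ`, then `t ∈ ℓ T_ℓ A`. [folklore] -/
theorem exists_smul_of_natCast_smul_eq_pow_smul {k m : ℕ} (hk0 : k ≠ 0) (hkm : k < ℓ ^ m)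
    {t s : TateModule A ℓ} (h : (k : ℤ_[ℓ]) • t = (ℓ : ℤ_[ℓ]) ^ m • s) :
    ∃ s' : TateModule A ℓ, (ℓ : ℤ_[ℓ]) • s' = t := by
  obtain ⟨e, k', hk', rfl⟩ := Nat.exists_eq_pow_mul_and_not_dvd hk0 ℓ hℓ.out.one_lt.ne'
  have hk'0 : 0 < k' := Nat.pos_of_ne_zero fun h0 => hk' (h0 ▸ dvd_zero ℓ)
  have he : e < m := by
    by_contra hme
    rw [not_lt] at hme
    have : ℓ ^ m ≤ ℓ ^ e * k' :=
      (Nat.pow_le_pow_right hℓ.out.pos hme).trans (Nat.le_mul_of_pos_right _ hk'0)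
    omega
  obtain ⟨s', hs'⟩ := exists_pow_smul_of_natCast_smul_eq hk' he.le h
  obtain ⟨d, hd⟩ : ∃ d, m - e = d + 1 := ⟨m - e - 1, by omega⟩
  refine ⟨(ℓ : ℤ_[ℓ]) ^ d • s', ?_⟩
  rw [← hs', hd, pow_succ, mul_comm, mul_smul]

/-- If `k • t ∈ ℓᵐ T_ℓ A` for a natural number `0 < k < ℓ`, then `t ∈ ℓᵐ T_ℓ A`. [folklore] -/
theorem exists_pow_smul_of_natCast_smul_eq_pow_smul {k m : ℕ} (hk0 : k ≠ 0) (hkℓ : k < ℓ)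
    {t s : TateModule A ℓ} (h : (k : ℤ_[ℓ]) • t = (ℓ : ℤ_[ℓ]) ^ m • s) :
    ∃ s' : TateModule A ℓ, (ℓ : ℤ_[ℓ]) ^ m • s' = t := by
  have hk : ¬ ℓ ∣ k := fun hdvd => absurd (Nat.le_of_dvd (Nat.pos_of_ne_zero hk0) hdvd) (not_le.mpr hkℓ)
  have h' : ((ℓ ^ 0 * k : ℕ) : ℤ_[ℓ]) • t = (ℓ : ℤ_[ℓ]) ^ m • s := by rwa [pow_zero, one_mul]
  simpa using exists_pow_smul_of_natCast_smul_eq hk (Nat.zero_le m) h'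

/-- Components of `ℤ_ℓ`-multiples are `ℕ`-multiples: `projₘ (c • y) = (c mod ℓᵐ) • projₘ y`, so a
subgroup containing `projₘ y` contains all `projₘ (c • y)`. [folklore] -/
theorem proj_smul_mem {X : AddSubgroup A} {m : ℕ} {y : TateModule A ℓ} (hy : proj ℓ m y ∈ X)
    (c : ℤ_[ℓ]) : proj ℓ m (c • y) ∈ X := by
  rw [proj_smul]
  exact X.nsmul_mem hy _

end Tate

/-! ### Rank-two endomorphisms: Cayley–Hamilton with a prescribed determinant -/

section RankTwo

variable {ℓ : ℕ} [hℓ : Fact ℓ.Prime] {T : Type u} [AddCommGroup T] [Module ℤ_[ℓ] T]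
  [Module.Free ℤ_[ℓ] T] [Module.Finite ℤ_[ℓ] T]

omit [Module.Free ℤ_[ℓ] T] [Module.Finite ℤ_[ℓ] T] in
/-- `det` and base change to `ℚ_ℓ`: `g ⊗ ℚ_ℓ - 1 = (g - 1) ⊗ ℚ_ℓ`. [folklore] -/
theorem baseChange_sub_one (g : T →ₗ[ℤ_[ℓ]] T) :
    (g.baseChange ℚ_[ℓ] - 1 : Module.End ℚ_[ℓ] (TensorProduct ℤ_[ℓ] ℚ_[ℓ] T)) =
      (g - 1).baseChange ℚ_[ℓ] := by
  rw [LinearMap.baseChange_sub, LinearMap.baseChange_one]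

/-- If `g ⊗ ℚ_ℓ - 1` is not surjective on `ℚ_ℓ ⊗ T` then `det (g - 1) = 0` in `ℤ_ℓ`. [folklore] -/
theorem det_sub_one_eq_zero_of_not_surjective (g : T →ₗ[ℤ_[ℓ]] T)
    (hns : ¬ Function.Surjective
      (g.baseChange ℚ_[ℓ] - 1 : Module.End ℚ_[ℓ] (TensorProduct ℤ_[ℓ] ℚ_[ℓ] T))) :
    LinearMap.det (g - 1) = 0 := by
  have hinj : Function.Injective (algebraMap ℤ_[ℓ] ℚ_[ℓ]) := fun x y hxy => by exact_mod_cast hxy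
  apply hinj
  rw [_root_.map_zero, ← LinearMap.det_baseChange, ← baseChange_sub_one]
  by_contra hdet
  apply hns
  have hu : IsUnit (g.baseChange ℚ_[ℓ] - 1 : Module.End ℚ_[ℓ] (TensorProduct ℤ_[ℓ] ℚ_[ℓ] T)) :=
    (LinearMap.isUnit_iff_isUnit_det _).mpr (Ne.isUnit hdet)
  exact ((Module.End.isUnit_iff _).mp hu).2

/-- **Cayley–Hamilton with `det (g - 1) = 0`.**  For an endomorphism `g` of a free `ℤ_ℓ`-module
of rank two with `det g = u` and `det (g - 1) = 0`: `tr g = 1 + u`, hence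
`(g - 1) ∘ (g - u) = 0` and `(g - u) ∘ (g - 1) = 0`. [folklore] -/
theorem comp_sub_smul_eq_zero_of_det (h2 : Module.finrank ℤ_[ℓ] T = 2) (g : T →ₗ[ℤ_[ℓ]] T)
    {u : ℤ_[ℓ]} (hdet : LinearMap.det g = u) (hdet1 : LinearMap.det (g - 1) = 0) :
    (∀ x, (g - 1) ((g - u • 1) x) = 0) ∧ ∀ x, (g - u • 1) ((g - 1) x) = 0 := by
  classical
  let b : Module.Basis (Fin 2) ℤ_[ℓ] T := Module.finBasisOfFinrankEq ℤ_[ℓ] T h2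
  set M := LinearMap.toMatrix b b g with hM
  have hdetM : M.det = u := by rw [hM, LinearMap.det_toMatrix, hdet]
  have hdet1M : (M - 1).det = 0 := by
    rw [hM, ← LinearMap.toMatrix_one b, ← _root_.map_sub, LinearMap.det_toMatrix, hdet1]
  have htr : M.trace = 1 + u := by
    rw [Matrix.det_fin_two] at hdetM hdet1M
    rw [Matrix.trace_fin_two]
    simp only [Matrix.sub_apply, Matrix.one_apply_eq, Matrix.one_apply_ne (by decide : (0 : Fin 2) ≠ 1),
      Matrix.one_apply_ne (by decide : (1 : Fin 2) ≠ 0), sub_zero] at hdet1M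
    linear_combination hdetM - hdet1M
  -- Cayley–Hamilton: `g² - (1 + u) g + u = 0`
  have hCH : g * g - (1 + u) • g + u • (1 : Module.End ℤ_[ℓ] T) = 0 := by
    have h := LinearMap.aeval_self_charpoly g
    rw [← LinearMap.charpoly_toMatrix g b, ← hM, Matrix.charpoly_fin_two, htr, hdetM] at h
    simp only [_root_.map_add, _root_.map_sub, _root_.map_mul, aeval_C, aeval_X,
      Algebra.algebraMap_eq_smul_one, sq] at h
    rw [← add_smul, smul_mul_assoc, one_mul] at h
    exact h
  have hfac1 : (g - 1) * (g - u • 1) = g * g - (1 + u) • g + u • (1 : Module.End ℤ_[ℓ] T) := by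
    simp only [sub_mul, mul_sub, one_mul, mul_one, mul_smul_comm, add_smul, one_smul, smul_sub]
    abel
  have hfac2 : (g - u • 1) * (g - 1) = g * g - (1 + u) • g + u • (1 : Module.End ℤ_[ℓ] T) := by
    simp only [sub_mul, mul_sub, mul_one, one_mul, smul_mul_assoc, add_smul, one_smul]
    abel
  constructor
  · intro x
    have := LinearMap.congr_fun (hfac1.trans hCH) x
    simpa using this
  · intro x
    have := LinearMap.congr_fun (hfac2.trans hCH) x
    simpa using this

omit [Module.Free ℤ_[ℓ] T] [Module.Finite ℤ_[ℓ] T] in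
/-- **`(g - 1) T ⊆ ℓ T` forces `det g ≡ 1 (mod ℓ)`** (rank two): the entries of the matrix of
`g - 1` are divisible by `ℓ`, and `det (1 + ℓ N) = 1 + ℓ (tr N + ℓ det N)`. [folklore] -/
theorem dvd_det_sub_one_of_forall (b : Module.Basis (Fin 2) ℤ_[ℓ] T) (g : T →ₗ[ℤ_[ℓ]] T)
    (h : ∀ j : Fin 2, ∃ s : T, (ℓ : ℤ_[ℓ]) • s = g (b j) - b j) :
    (ℓ : ℤ_[ℓ]) ∣ LinearMap.det g - 1 := by
  classical
  choose s hs using h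
  -- entries of the matrix of `g`: `M i j = δ i j + ℓ (b.repr (s j) i)`
  have hentry : ∀ i j : Fin 2, LinearMap.toMatrix b b g i j =
      (if i = j then 1 else 0) + (ℓ : ℤ_[ℓ]) * b.repr (s j) i := by
    intro i j
    rw [LinearMap.toMatrix_apply]
    have e : g (b j) = b j + (ℓ : ℤ_[ℓ]) • s j := by rw [hs j]; abel
    rw [e, _root_.map_add, map_smul, Finsupp.add_apply, Finsupp.smul_apply, Module.Basis.repr_self,
      Finsupp.single_apply, smul_eq_mul]
    simp only [eq_comm]
  rw [← LinearMap.det_toMatrix b, Matrix.det_fin_two, hentry, hentry, hentry, hentry]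
  simp only [if_true, show ((0 : Fin 2) = 1) = False from by decide,
    show ((1 : Fin 2) = 0) = False from by decide, if_false, zero_add]
  exact ⟨b.repr (s 0) 0 + b.repr (s 1) 1 + ℓ * (b.repr (s 0) 0 * b.repr (s 1) 1) -
      ℓ * (b.repr (s 1) 0 * b.repr (s 0) 1), by ring⟩

end RankTwo

end Summit.Langlands.Langlands.Theorems.FiveIsogenyEllipticCurves

end
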